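import Summits.QuantumFields.YangMills.Theorems.LuscherReductionDressedRitzLiftLeakageResidual
import Summits.QuantumFields.YangMills.Theorems.LuscherReductionDressedRitzVacuumDictionary
import HarnessLib

/-!
# Crux `DressedRitz` (stmt-QuantumFields-20205), line «polyakovlift», stub S-POS `stub_liftPosition` — support III:
# the Lüscher position (o5) from an EXACT-LEVEL position + SLOW leakage + STIFF weight (Pythagorean form split, variational squaring)

Support module (LEAD prover ym-lead-20205-polyakovlift g0; `--supports stmt-QuantumFields-20205`, helper, no closure claim) for the registered
load-bearing stub `…Cruxes.DressedRitz.PolyakovLift.stub_liftPosition` (skeleton r2 62fcf7b4f9c136d2), clause (o5) of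
`PolyakovLift.DynamicCoreClauses`:  `d_i μ₀ ≤ e^{Cλ²/L}(μ_{i+1}λ₀) n_i` and `(μ_{i+1}λ₀) n_i ≤ e^{Cλ²/L} d_i μ₀`, `d_i = ⟨u_i,K_βu_i⟩`, `n_i = ‖u_i‖²`.

THE STRUCTURE IT MAKES KERNEL-CHECKED (blueprint §2(d): «S-POS ≈ RED-precision ∧ NEAR»).  Against a finite exact physical `l2`-orthonormal
eigenfamily `ψ_0 … ψ_{N−1}` (`K_βψ_l = λ_lψ_l`; the tree supplies them with domination, `LiftLeak.exists_eigenfamily_dominating`) every physical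
`u` splits PYTHAGOREANLY (`form_split_eigenfamily`):

  `‖u‖² = Σ_l ⟨u,ψ_l⟩² + ‖r‖²`,   `⟨u,K_βu⟩ = Σ_l λ_l⟨u,ψ_l⟩² + ⟨r,K_βr⟩`,   `r = u − Σ_l⟨u,ψ_l⟩ψ_l ⊥ ψ`.

Hence for ANY designated level `κ = λ_{l*} ∈ [0, λ₀]` (`position_defect_le`):

  `|⟨u,K_βu⟩ − κ‖u‖²| ≤ Σ_l |λ_l − κ|·⟨u,ψ_l⟩² + λ₀‖r‖²`   (the `l = l*` term vanishes; `0 ≤ ⟨r,K_βr⟩ ≤ λ₀‖r‖²`),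

and (o5) follows (`coreO5_of_slow_stiff`, VERBATIM text, constant `C₁ + C₂`) from: (P) the EXACT level `κ` sits in Lüscher position with slack
`e^{C₁λ²/L}` — this is the parent crux RED's precision statement for that level; (S+T) the budget `Σ_l |λ_l − κ|⟨u_i,ψ_l⟩² + λ₀‖r_i‖² ≤
(1 − e^{−C₂λ²/L})·κ·‖u_i‖²` — SLOW leakage weights `⟨û_i,ψ_l⟩² = O(λ²)` (even `O(λ)` suffices) at levers `|λ_l − κ| ≍ (λ/L)λ₀` give `O(λ³/L)`,
one order inside; the STIFF weight `‖r_i‖²/‖u_i‖²` must be `O(λ²/L)` — for the flowed lift it is `O(e^{−8π²/√λ}) + O(λ⁷/L)` heuristically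
(blueprint §2(b)).  So the variational principle SQUARES the trial-vector error: an `O(√λ)`-quasimode in norm already gives the relative-`O(λ)`
position, PROVIDED the exact level is where RED says.  This is why S-POS is not easier than RED's precision half, and why the line's content is
the NEAR statement (quasimodes from explicit flowed insertions) on top of it.

* `form_split_abstract` — the two Pythagorean identities for a symmetric bilinear form and an `ip`-symmetric `K` (any real vector space);
* `form_split_eigenfamily` — the same over the tree's physical subspace (`physSubmodule`, `l2Form`, `transferOp`);
* `position_defect_le` — `|d − κn| ≤ Σ|λ_l − κ|w_l + λ₀‖r‖²`;
* `two_sub_exp_neg_le_exp` — `2 − e^{−x} ≤ e^{x}`;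
* ★ `coreO5_of_slow_stiff` — (o5) conjunct of `DynamicCoreClauses`, VERBATIM, from (P) + (S+T).

HONEST FRAMING: fixed-lattice functional analysis on the conditional femto rung R2b1; the stub `stub_liftPosition` stays OPEN; nothing here bears
on infinite volume, the continuum limit or the Clay gap.  References: Reed–Simon IV, Thm XIII.1 [cite: ReedSimonIV1978, Thm XIII.1];
M. Lüscher, NPB 219 (1983) 233 [cite: Luscher1983, §3]; T. Kato, J. Phys. Soc. Japan 4 (1949) 334 [cite: Kato1949, §1].
-/

set_option autoImplicit false

noncomputable section

open MeasureTheory Filter Topology Real Finset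
open Literature.MathematicalPhysics.QuantumFieldTheory
open Literature.MathematicalPhysics.QuantumLattice
open Literature.Analysis.OperatorTheory
open scoped BigOperators

namespace Summit.QuantumFields.YangMills.Theorems.FemtoTransferGap.LiftPos

open Summit.QuantumFields.YangMills.Theorems.FemtoTransferGap
open Summit.QuantumFields.YangMills.Theorems.FemtoTransferGap.LiftLeak

/-! ## §1 The Pythagorean form split (abstract) -/

section Abstract

variable {D : Type*} [AddCommGroup D] [Module ℝ D]

/-- **Pythagorean form split** against `ip`-orthonormal exact eigenvectors `e_0 … e_{N−1}` of an `ip`-symmetric `K` (`ip` symmetric):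
with `w_l = ip(x,e_l)` and `r = x − Σ_l w_l e_l`, `ip(x,x) = Σ_l w_l² + ip(r,r)` and `ip(x,Kx) = Σ_l λ_l w_l² + ip(r,Kr)`. [cite: ReedSimonIV1978, Thm XIII.1] -/
theorem form_split_abstract (ip : D →ₗ[ℝ] D →ₗ[ℝ] ℝ) (hip : ∀ x y, ip x y = ip y x) (K : D →ₗ[ℝ] D)
    (hK : ∀ x y, ip (K x) y = ip x (K y)) {N : ℕ} (e : Fin N → D) (ev : Fin N → ℝ)
    (hon : ∀ i l, ip (e i) (e l) = if i = l then 1 else 0) (heig : ∀ j, K (e j) = ev j • e j) (x : D) :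
    ip x x = ∑ j, ip x (e j) ^ 2 + ip (x - ∑ j, ip x (e j) • e j) (x - ∑ j, ip x (e j) • e j) ∧
      ip x (K x) = ∑ j, ev j * ip x (e j) ^ 2 + ip (x - ∑ j, ip x (e j) • e j) (K (x - ∑ j, ip x (e j) • e j)) := by
  classical
  set r : D := x - ∑ j, ip x (e j) • e j with hr_def
  set p : D := ∑ j, ip x (e j) • e j with hp_def
  have hr : ∀ l, ip r (e l) = 0 := ip_remainder_eq_zero ip e hon x
  have hKr : ∀ l, ip (K r) (e l) = 0 := ip_apply_eigen_eq_zero ip K hK e ev heig hr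
  have hx : x = p + r := by rw [hr_def, hp_def]; abel
  -- Gram entries
  have hpr : ip p r = 0 := by
    rw [hp_def, bilin_sum_smul_left]
    exact sum_eq_zero fun j _ => by rw [hip (e j) r, hr j, mul_zero]
  have hrp : ip r p = 0 := by rw [hip]; exact hpr
  have hpp : ip p p = ∑ j, ip x (e j) ^ 2 := by
    rw [hp_def, bilin_sum_smul_sum_smul]
    refine sum_congr rfl fun j _ => ?_
    simp only [hon, mul_ite, mul_one, mul_zero, Finset.sum_ite_eq, Finset.mem_univ, if_true]
    ring
  have hKp : K p = ∑ j, (ip x (e j) * ev j) • e j := by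
    rw [hp_def, map_sum]
    refine sum_congr rfl fun j _ => ?_
    rw [map_smul, heig, smul_smul]
  have hpKp : ip p (K p) = ∑ j, ev j * ip x (e j) ^ 2 := by
    rw [hKp, hp_def, bilin_sum_smul_sum_smul]
    refine sum_congr rfl fun j _ => ?_
    simp only [hon, mul_ite, mul_one, mul_zero, Finset.sum_ite_eq, Finset.mem_univ, if_true]
    ring
  have hrKp : ip r (K p) = 0 := by
    rw [hKp, bilin_sum_smul_right]
    exact sum_eq_zero fun j _ => by rw [hr j, mul_zero]
  have hpKr : ip p (K r) = 0 := by
    rw [hip, hK]; exact hrKp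
  constructor
  · conv_lhs => rw [hx]
    simp only [map_add, LinearMap.add_apply, hpr, hrp, hpp, add_zero, zero_add]
  · conv_lhs => rw [hx]
    simp only [map_add, LinearMap.add_apply, hpKp, hrKp, hpKr, add_zero, zero_add]

end Abstract

/-! ## §2 The form split and the position defect over the tree's physical subspace -/

section Femto

variable {L : ℕ} [NeZero L]

/-- **Pythagorean form split against a finite exact physical eigenfamily**: `ψ_0 … ψ_{N−1}` physical, `l2`-orthonormal, `K_βψ_l = λ_lψ_l`;
for every physical `u`, with `r = u − Σ_l⟨u,ψ_l⟩ψ_l`: `‖u‖² = Σ_l⟨u,ψ_l⟩² + ‖r‖²` and `⟨u,K_βu⟩ = Σ_l λ_l⟨u,ψ_l⟩² + ⟨r,K_βr⟩`.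
[cite: ReedSimonIV1978, Thm XIII.1] -/
theorem form_split_eigenfamily (β : ℝ) {N : ℕ} {ψ : Fin N → (GaugeConfig 3 L SU2 → ℝ)} (hψ : ∀ j, IsPhys (ψ j))
    (hon : ∀ i l, l2 (ψ i) (ψ l) = if i = l then 1 else 0) (ev : Fin N → ℝ)
    (heig : ∀ j, transferApply β (ψ j) = ev j • ψ j) {u : GaugeConfig 3 L SU2 → ℝ} (hu : IsPhys u) :
    l2 u u = ∑ j, l2 u (ψ j) ^ 2 + l2 (u - ∑ j, l2 u (ψ j) • ψ j) (u - ∑ j, l2 u (ψ j) • ψ j) ∧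
      l2 u (transferApply β u) =
        ∑ j, ev j * l2 u (ψ j) ^ 2 + l2 (u - ∑ j, l2 u (ψ j) • ψ j) (transferApply β (u - ∑ j, l2 u (ψ j) • ψ j)) := by
  set e : Fin N → physSubmodule L := fun j => ⟨ψ j, hψ j⟩ with he
  have hon' : ∀ i l, l2Form L (e i) (e l) = if i = l then 1 else 0 := fun i l => by
    simpa only [l2Form_apply, he, Submodule.coe_mk] using hon i l
  have heig' : ∀ j, transferOp β (e j) = ev j • e j := fun j => by
    apply Subtype.ext
    simpa only [coe_transferOp, Submodule.coe_smul, he, Submodule.coe_mk] using heig j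
  have h := form_split_abstract (l2Form L) l2Form_symm (transferOp β) (transferOp_symm β) e ev hon' heig' ⟨u, hu⟩
  simpa only [l2Form_apply, coe_transferOp, Submodule.coe_sub, Submodule.coe_sum, Submodule.coe_smul, Submodule.coe_mk, he] using h

/-- The remainder after removing finitely many physical components is physical. [folklore] -/
theorem isPhys_remainder {N : ℕ} {ψ : Fin N → (GaugeConfig 3 L SU2 → ℝ)} (hψ : ∀ j, IsPhys (ψ j))
    {u : GaugeConfig 3 L SU2 → ℝ} (hu : IsPhys u) : IsPhys (u - ∑ j, l2 u (ψ j) • ψ j) := by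
  have h : IsPhys (((⟨u, hu⟩ : physSubmodule L) - ∑ j, l2 u (ψ j) • (⟨ψ j, hψ j⟩ : physSubmodule L) : physSubmodule L) :
      GaugeConfig 3 L SU2 → ℝ) := isPhys_coe _
  simpa only [Submodule.coe_sub, Submodule.coe_sum, Submodule.coe_smul, Submodule.coe_mk] using h

/-- ★ **Position defect**: against a finite exact physical eigenfamily and ANY designated value `κ ∈ [0, λ₀]`, for every physical `u`:
`|⟨u,K_βu⟩ − κ‖u‖²| ≤ Σ_l |λ_l − κ|·⟨u,ψ_l⟩² + λ₀·‖r‖²` (`r` the remainder; uses `0 ≤ ⟨r,K_βr⟩ ≤ λ₀‖r‖²`, `β ≥ 0`). [cite: Kato1949, §1] -/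
theorem position_defect_le {β : ℝ} (hβ : 0 ≤ β) {N : ℕ} {ψ : Fin N → (GaugeConfig 3 L SU2 → ℝ)} (hψ : ∀ j, IsPhys (ψ j))
    (hon : ∀ i l, l2 (ψ i) (ψ l) = if i = l then 1 else 0) (ev : Fin N → ℝ)
    (heig : ∀ j, transferApply β (ψ j) = ev j • ψ j) {u : GaugeConfig 3 L SU2 → ℝ} (hu : IsPhys u)
    {κ : ℝ} (hκ0 : 0 ≤ κ) (hκ1 : κ ≤ levelValue su2Rep L β 0) :
    |l2 u (transferApply β u) - κ * l2 u u| ≤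
      ∑ j, |ev j - κ| * l2 u (ψ j) ^ 2 +
        levelValue su2Rep L β 0 * l2 (u - ∑ j, l2 u (ψ j) • ψ j) (u - ∑ j, l2 u (ψ j) • ψ j) := by
  obtain ⟨hn, hd⟩ := form_split_eigenfamily β hψ hon ev heig hu
  set r := u - ∑ j, l2 u (ψ j) • ψ j with hr
  have hrP : IsPhys r := isPhys_remainder hψ hu
  have hrr : 0 ≤ l2 r r := l2_self_nonneg r
  have hK0 : 0 ≤ l2 r (transferApply β r) := by
    rw [← qform_eq_l2_transferApply]; exact qform_su2Rep_self_nonneg hβ hrP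
  have hK1 : l2 r (transferApply β r) ≤ levelValue su2Rep L β 0 * l2 r r := by
    rw [← qform_eq_l2_transferApply]; exact VacDict.qform_self_le_levelValue_zero_mul β hrP
  have hs : ∑ j, (ev j - κ) * l2 u (ψ j) ^ 2 = ∑ j, ev j * l2 u (ψ j) ^ 2 - κ * ∑ j, l2 u (ψ j) ^ 2 := by
    rw [Finset.mul_sum, ← Finset.sum_sub_distrib]
    exact Finset.sum_congr rfl fun j _ => by ring
  have hdiff : l2 u (transferApply β u) - κ * l2 u u =
      ∑ j, (ev j - κ) * l2 u (ψ j) ^ 2 + (l2 r (transferApply β r) - κ * l2 r r) := by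
    rw [hd, hn, hs]; ring
  rw [hdiff]
  have hrest : |l2 r (transferApply β r) - κ * l2 r r| ≤ levelValue su2Rep L β 0 * l2 r r := by
    rw [abs_le]
    constructor
    · have : κ * l2 r r ≤ levelValue su2Rep L β 0 * l2 r r := mul_le_mul_of_nonneg_right hκ1 hrr
      linarith
    · have : 0 ≤ κ * l2 r r := mul_nonneg hκ0 hrr
      linarith
  have hsum : |∑ j, (ev j - κ) * l2 u (ψ j) ^ 2| ≤ ∑ j, |ev j - κ| * l2 u (ψ j) ^ 2 := by
    refine (Finset.abs_sum_le_sum_abs _ _).trans (le_of_eq (Finset.sum_congr rfl fun j _ => ?_))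
    rw [abs_mul, abs_of_nonneg (sq_nonneg (l2 u (ψ j)))]
  exact (abs_add_le _ _).trans (add_le_add hsum hrest)

/-! ## §3 ★ (o5) from an exact-level position + the slow/stiff budget -/

/-- `2 − e^{−x} ≤ e^{x}` (AM–GM for `e^{x}, e^{−x}`). [folklore] -/
theorem two_sub_exp_neg_le_exp (x : ℝ) : 2 - Real.exp (-x) ≤ Real.exp x := by
  have h1 : Real.exp x * Real.exp (-x) = 1 := by rw [← Real.exp_add, add_neg_cancel, Real.exp_zero]
  nlinarith [sq_nonneg (Real.exp x - 1), Real.exp_pos x, Real.exp_pos (-x)]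

/-- ★★ **(o5) of `PolyakovLift.DynamicCoreClauses k (C₁ + C₂) β u`, VERBATIM, from an EXACT-LEVEL POSITION and the SLOW/STIFF BUDGET.**  For each
`i`: an exact physical `l2`-orthonormal eigenfamily `ψ` (levels `λ_l`, any length), a designated member `κ = λ_{l*} ∈ [0, λ₀]` in Lüscher position
`κμ₀ ≤ e^{C₁λ²/L}μ_{i+1}λ₀`, `μ_{i+1}λ₀ ≤ e^{C₁λ²/L}κμ₀` (RED's statement for that level), and the budget
`Σ_l |λ_l − κ|⟨u_i,ψ_l⟩² + λ₀‖r_i‖² ≤ (1 − e^{−C₂λ²/L})·κ·‖u_i‖²`.  Then the two (o5) inequalities with constant `C₁ + C₂`.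
(`μ_j = levelValue su2Rep 1 (oneSiteCoupling β L) j`, `λ₀ = levelValue su2Rep L β 0`, `μ₀ ≥ 0` needed.) [cite: Luscher1983, §3] [cite: Kato1949, §1] -/
theorem coreO5_of_slow_stiff {k : ℕ} (C₁ C₂ : ℝ) {β : ℝ} (hβ : 0 ≤ β) (hμ0 : 0 ≤ levelValue su2Rep 1 (oneSiteCoupling β L) 0)
    {u : Fin k → (GaugeConfig 3 L SU2 → ℝ)} (hu : ∀ i, IsPhys (u i))
    (h : ∀ i : Fin k, ∃ (N : ℕ) (ψ : Fin N → (GaugeConfig 3 L SU2 → ℝ)) (ev : Fin N → ℝ) (κ : ℝ),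
      (∀ j, IsPhys (ψ j)) ∧ (∀ j l, l2 (ψ j) (ψ l) = if j = l then 1 else 0) ∧
      (∀ j, transferApply β (ψ j) = ev j • ψ j) ∧ 0 ≤ κ ∧ κ ≤ levelValue su2Rep L β 0 ∧
      κ * levelValue su2Rep 1 (oneSiteCoupling β L) 0 ≤
        Real.exp (C₁ * luscherLambda β L ^ 2 / L) * (levelValue su2Rep 1 (oneSiteCoupling β L) ((i : ℕ) + 1) * levelValue su2Rep L β 0) ∧
      levelValue su2Rep 1 (oneSiteCoupling β L) ((i : ℕ) + 1) * levelValue su2Rep L β 0 ≤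
        Real.exp (C₁ * luscherLambda β L ^ 2 / L) * (κ * levelValue su2Rep 1 (oneSiteCoupling β L) 0) ∧
      ∑ j, |ev j - κ| * l2 (u i) (ψ j) ^ 2 +
          levelValue su2Rep L β 0 * l2 (u i - ∑ j, l2 (u i) (ψ j) • ψ j) (u i - ∑ j, l2 (u i) (ψ j) • ψ j) ≤
        (1 - Real.exp (-(C₂ * luscherLambda β L ^ 2 / L))) * (κ * l2 (u i) (u i))) :
    ∀ i : Fin k,
      l2 (u i) (transferApply β (u i)) * levelValue su2Rep 1 (oneSiteCoupling β L) 0 ≤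
          Real.exp ((C₁ + C₂) * luscherLambda β L ^ 2 / L) *
            (levelValue su2Rep 1 (oneSiteCoupling β L) ((i : ℕ) + 1) * levelValue su2Rep L β 0) * l2 (u i) (u i) ∧
      levelValue su2Rep 1 (oneSiteCoupling β L) ((i : ℕ) + 1) * levelValue su2Rep L β 0 * l2 (u i) (u i) ≤
          Real.exp ((C₁ + C₂) * luscherLambda β L ^ 2 / L) *
            (l2 (u i) (transferApply β (u i)) * levelValue su2Rep 1 (oneSiteCoupling β L) 0) := by
  intro i
  obtain ⟨N, ψ, ev, κ, hψ, hon, heig, hκ0, hκ1, hposA, hposB, hbudget⟩ := h i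
  set d := l2 (u i) (transferApply β (u i)) with hd
  set n := l2 (u i) (u i) with hn
  set μ0 := levelValue su2Rep 1 (oneSiteCoupling β L) 0 with hμ0def
  set μ1 := levelValue su2Rep 1 (oneSiteCoupling β L) ((i : ℕ) + 1) with hμ1def
  set l0 := levelValue su2Rep L β 0 with hl0def
  set E₁ := Real.exp (C₁ * luscherLambda β L ^ 2 / L) with hE₁def
  set E₂ := Real.exp (C₂ * luscherLambda β L ^ 2 / L) with hE₂def
  set E₂' := Real.exp (-(C₂ * luscherLambda β L ^ 2 / L)) with hE₂'def
  have hE1 : 0 < E₁ := Real.exp_pos _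
  have hE2 : 0 < E₂ := Real.exp_pos _
  have hexp_add : Real.exp ((C₁ + C₂) * luscherLambda β L ^ 2 / L) = E₁ * E₂ := by
    rw [hE₁def, hE₂def, ← Real.exp_add]; congr 1; ring
  have hinv : E₂ * E₂' = 1 := by
    rw [hE₂def, hE₂'def, ← Real.exp_add, add_neg_cancel, Real.exp_zero]
  have h2 : 2 - E₂' ≤ E₂ := two_sub_exp_neg_le_exp _
  have hn0 : 0 ≤ n := l2_self_nonneg _
  have hκn : 0 ≤ κ * n := mul_nonneg hκ0 hn0
  -- the defect bound
  have hdef : |d - κ * n| ≤ (1 - E₂') * (κ * n) :=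
    (position_defect_le hβ hψ hon ev heig (hu i) hκ0 hκ1).trans hbudget
  rw [abs_le] at hdef
  obtain ⟨hlow, hupp⟩ := hdef
  -- `E₂' κ n ≤ d ≤ E₂ κ n`
  have hdlo : E₂' * (κ * n) ≤ d := by nlinarith
  have hdhi : d ≤ E₂ * (κ * n) := by nlinarith
  rw [hexp_add]
  constructor
  · calc d * μ0 ≤ E₂ * (κ * n) * μ0 := mul_le_mul_of_nonneg_right hdhi hμ0
      _ = E₂ * n * (κ * μ0) := by ring
      _ ≤ E₂ * n * (E₁ * (μ1 * l0)) := mul_le_mul_of_nonneg_left hposA (mul_nonneg hE2.le hn0)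
      _ = E₁ * E₂ * (μ1 * l0) * n := by ring
  · have hk : κ * n ≤ E₂ * d := by
      have h1 : E₂ * (E₂' * (κ * n)) ≤ E₂ * d := mul_le_mul_of_nonneg_left hdlo hE2.le
      calc κ * n = E₂ * E₂' * (κ * n) := by rw [hinv, one_mul]
        _ = E₂ * (E₂' * (κ * n)) := by ring
        _ ≤ E₂ * d := h1
    calc μ1 * l0 * n ≤ E₁ * (κ * μ0) * n := mul_le_mul_of_nonneg_right hposB hn0
      _ = E₁ * μ0 * (κ * n) := by ring
      _ ≤ E₁ * μ0 * (E₂ * d) := mul_le_mul_of_nonneg_left hk (mul_nonneg hE1.le hμ0)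
      _ = E₁ * E₂ * (d * μ0) := by ring

end Femto

end Summit.QuantumFields.YangMills.Theorems.FemtoTransferGap.LiftPos

end
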